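import Summits.QuantumFields.YangMills.Theorems.BalabanUVNodesN13Cor3AEIffUpToVersionAtRecord13
import Summits.QuantumFields.YangMills.Theorems.BalabanUVNodesN13UVRowOfUpperAndSmallLocus
import Literature.MathematicalPhysics.QuantumFieldTheory.Balaban1983to89.Node00.Record13SepCoPHV

/-!
# BalabanUVNodes ∕ N13 — THE (δⱽ) VERSION SLOT's SUPPLIER IN THE K1 ENGINES' LETTERS, LEVEL 0 KEPT: Theorem 1 at the datum + the engines' N13 row `hUV` with «every `U`» at
# level 0 and «`dV`-a.e. `U`» at levels ≥ 1 ⟹ densities `ρ′` EQUAL to the record's at level 0, `=ᵐ[dV]` at every level, with `B16.EndStatementBPrinted` AS TYPED of the construction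
# `{(datumOfRecord₁₃SepCoPH θ h).C P with ρ := ρ′ P}`, and — through node00 DEF-1's version slot p620607 `Node00/Record13SepCoPHV` — the K1⁹-shaped conjunct
# `∃ v : Revision₁₃ F N θ h, B16.EndStatementBPrinted (datumOfRecord₁₃SepCoPHⱽ F N θ h v).C`

Cell `pub-ymgap` (HUMAN RULING D-0062 Track A ∕ D-0149 width), WIDTH SEAT `pub-ymgap-dag-n13-w2` (gen 4, INTENT-3′ — the shrunk form after YIELD l.34783 on COLLISION-1; plan g85 l.34825: «the record junction in the
engines' letters = n13-w2 INTENT-3′»), key K1⁸ `StabilityBRunRowsAtRecordR13SepCoPH` = stmt-QuantumFields-26907 (`--kind proof --supports … --as helper`; count-neutral).  SEQUEL of p619268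
`…N13Cor3AEIffUpToVersionAtRecord13` (imports it only).  DISJOINT from dag-n13-w1 g5's `Literature/…/T4DatumAssemblyTowerReviseAE` (TOWER ∕ datum `∃ τ′` forms in B16's bare letters — not restated here:
this file stays at the `B16.Construction` level and in the engines' letters) and from DEF-1's definitions (`Tower.revise`, `Revision₁₃`, `datumOfRecord₁₃SepCoPHⱽ` — none used or restated).
[III] = [Balaban1988Convergent], [B16] = [Balaban1989LargeFieldII], [I] = [Balaban1987RG1].

WHAT THIS FILE PROVES (theorems only; 0 `def`; no `instance`, no `notation`; standard axioms; NO route-file import).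
§1 [bookkeeping] GENERIC over a core `M : T4DatumAssembly.RGMachineCore F G` and a density family `ρ` (any gauge group, any family): `construction_update_rho` (`(fun p => {M.construction ρ p with ρ := ρ′ p})
   = M.construction ρ′`, `rfl`) and ★★ `exists_rho_keep0_ae_eq_endStatementBPrinted_construction_of_thm1_of_ae` — `χ ≤ 1`, `0 ≤ A^η`, `B16.Thm1Printed (M.construction ρ)`, (2.50) on the window at level 0 at
   EVERY field and at each level `k+1 ≤ K` for `dV`-a.e. field ⟹ `∃ ρ′, (∀ p, ρ′ p 0 = ρ p 0) ∧ (∀ p k, ρ′ p k =ᵐ[dV] ρ p k) ∧ B16.EndStatementBPrinted (M.construction ρ′)` (p619268 §1 with the exceptional sets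
   EMPTY at level 0 — «the slot never re-chooses level 0»).
§2 AT NODE 00's STAGE-13 RECORD, IN THE ENGINES' LETTERS: ★★★ `exists_rho_keep0_ae_eq_endStatementBPrinted_record_of_thm1_of_row0_of_aeRowSucc` — `B16.Thm1Printed (datumOfRecord₁₃SepCoPH θ h).C` + the K1 engines' N13 row
   `hUV` (window `γ`, guard `SLaw₁₃CoPH` — paid by Theorem 1 on `]0, min γ γ₁]` —, `em`∕`ep` of `g_k`; «every `U`» at level 0, «`dV`-a.e. `U`» at levels `k+1`) ⟹ `∃ ρ′, (∀ P, ρ′ P 0 = densOfRecord₁₃ θ P 0) ∧ (∀ P k, ρ′ P k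
   =ᵐ[dV] densOfRecord₁₃ θ P k) ∧ B16.EndStatementBPrinted (fun P => {(datumOfRecord₁₃SepCoPH θ h).C P with ρ := ρ′ P})`; and `…_succGuarded` (the `k < P.K`-guarded successor form of the a.e. clause, DEF-1's
   `Revision₁₃.ae_eq_succ` letter).
§3 ★ `ae_uvLower_of_ae_smallLocus` — the `dV`-a.e. TWIN of dag-n13-w1's junction `uvLower_of_smallLocus` (their per-field `uvLower_densOfRecord₁₃_of_plaquette_off_b0` BY NAME: off the small locus the
   (2.9) species vanishes and `ρ_k ≥ 0`) and ★★★ `exists_rho_keep0_ae_eq_endStatementBPrinted_record_of_thm1_of_row0_of_aeUpper_of_aeLowerSmall` — the slot's supplier from (U) «upper half» + (Lˢ)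
   «lower half on the small locus», BOTH asked only `dV`-a.e. at levels ≥ 1 (level 0 at every field), `εreg` in [Av] Prop. 2's range.
§4 THROUGH node00 DEF-1's VERSION SLOT (p620607 `Node00/Record13SepCoPHV`, adapter `exists_revision₁₃_endStatementBPrinted_of_exists_update` BY NAME): ★★★
   `exists_revision₁₃_endStatementBPrinted_of_thm1_of_row0_of_aeRowSucc` and ★★★ `…_of_thm1_of_row0_of_aeUpper_of_aeLowerSmall` — the K1⁹-shaped conjunct
   `∃ v : Revision₁₃ F N θ h, B16.EndStatementBPrinted (datumOfRecord₁₃SepCoPHV F N θ h v).C` from the engines' row ∕ from (U) + (Lˢ), version-free at levels ≥ 1.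

HONEST FRAMING.  Count-neutral bookkeeping; nothing of Bałaban's asserted or refuted; K1⁸ NEITHER proved NOR refuted; the displayed hypotheses (Theorem 1 at the datum — N11's T-row + [IV] selector laws,
p583899; the engines' row — the N13 node's (UV₁₃) content, now asked VERSION-FREE at levels ≥ 1 per director-ym №210 (5)) are nobody's theorem here; no route text changed or proposed; N13 NOT discharged; no stub
closed; counts unmoved (typed 28∕28 · discharged 5∕27 · A 5∕28); one finite `𝕋⁴_{L^K}` programme at fixed `ε = L^{−K}`, Bałaban AS PRINTED; route R4 closes the CONDITIONAL finite-𝕋⁴ rung `BalabanLadder.UV` only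
— the Yang–Mills mass gap (Clay) is NOT proved by any of this; nothing continuum ∕ ℝ⁴ ∕ OS.  No `sorry`.
-/

noncomputable section

open scoped ENNReal

namespace Summit.QuantumFields.YangMills.BalabanUVNodes.N13Cor3AEKeepZeroOfEnginesRowAtRecord13

open MeasureTheory Set
open Literature.MathematicalPhysics.QuantumFieldTheory.Balaban1983to89
open Literature.MathematicalPhysics.QuantumFieldTheory.Balaban1983to89.T4Continuum (T4Family)
open Literature.MathematicalPhysics.QuantumFieldTheory.Balaban1983to89.Node00
open Summit.QuantumFields.YangMills.BalabanUVNodes.N13Cor3AEIffUpToVersionAtRecord13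
  (exists_rho_eqOn_endStatementBPrinted_of_thm1_of_offSet signs_datum uvIneq_at_record₁₃SepCoPH_iff)
open Summit.QuantumFields.YangMills.BalabanUVNodes.N13UVChiOffSolvableAtRecord13 (uvLower_densOfRecord₁₃_of_plaquette_off_b0)
open Summit.QuantumFields.YangMills.BalabanUVNodes.N13UVRowOfUpperAndSmallLocus (le_m_add_K_of_le)
open ExpMeanLog (deltaSU)

/-! ## §1 GENERIC CORE FORM, LEVEL 0 KEPT -/

section Generic

open T4DatumAssembly FlowStepRuns

variable {F : T4Family} {G : Type} [GaugeGroup G] [MeasurableSpace G] [HaarData G] (M : RGMachineCore F G)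

/-- The structure update of a core construction's densities IS the core construction over the updated densities (`rfl`). [cite: Balaban1988Convergent, (0.2) p.244 (bookkeeping)] -/
theorem construction_update_rho (ρ ρ' : (p : B12.RunParams) → (k : ℕ) → Density (F.P p.K) k G) :
    (fun p => { M.construction ρ p with ρ := ρ' p }) = M.construction ρ' := rfl

open Classical in
/-- **★★ GENERIC CORE FORM, LEVEL 0 KEPT**: for a core `M` with `χ ≤ 1`, `0 ≤ A^η`, and a density family `ρ` with `B16.Thm1Printed (M.construction ρ)`: if on the window `]0, γ]` the
two-sided bound (2.50) holds at level `0` at EVERY field and at each level `k+1 ≤ K` for `dV`-almost every field, then there is a density family `ρ′` with `ρ′ p 0 = ρ p 0` (every run),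
`ρ′ p k =ᵐ[dV] ρ p k` (every run and level) and `B16.EndStatementBPrinted (M.construction ρ′)` (constants `γ`, `em`, `max ep (−em)`).  Bookkeeping over §1.
[cite: Balaban1989LargeFieldII, Thm 1 p.355, (0.1) pp.355–356; Balaban1988Convergent, Cor. 3 (2.50) p.264 (bookkeeping)] -/
theorem exists_rho_keep0_ae_eq_endStatementBPrinted_construction_of_thm1_of_ae (ρ : (p : B12.RunParams) → (k : ℕ) → Density (F.P p.K) k G)
    (hχ : ∀ p k V, M.χ p k V ≤ 1) (hA : ∀ p k V, 0 ≤ M.wilsonBG p k V) (h1 : B16.Thm1Printed (M.construction ρ)) {γ : ℝ} (hγ : 0 < γ) {em ep : ℝ → ℝ}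
    (h0 : ∀ p : B12.RunParams, (M.construction ρ p).flow.InInterval γ p.K → ∀ V,
      B16.UVIneq (M.construction ρ p) 0 V (em ((M.construction ρ p).flow.g 0)) (ep ((M.construction ρ p).flow.g 0)))
    (hae : ∀ p : B12.RunParams, (M.construction ρ p).flow.InInterval γ p.K → ∀ k, k + 1 ≤ p.K →
      ∀ᵐ V ∂(fieldMeasure (F.P p.K) (k + 1) G), B16.UVIneq (M.construction ρ p) (k + 1) V (em ((M.construction ρ p).flow.g (k + 1))) (ep ((M.construction ρ p).flow.g (k + 1)))) :
    ∃ ρ' : (p : B12.RunParams) → (k : ℕ) → Density (F.P p.K) k G,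
      (∀ p, ρ' p 0 = ρ p 0) ∧ (∀ p k, ρ' p k =ᵐ[fieldMeasure (F.P p.K) k G] ρ p k) ∧ B16.EndStatementBPrinted (M.construction ρ') := by
  -- exceptional sets: inside the window, where (2.50) fails (empty at level 0 by `h0`, null at levels ≥ 1 by `hae`); outside it, nothing
  let E : (p : B12.RunParams) → (k : ℕ) → Set (GaugeField (F.P p.K) k G) := fun p k =>
    {V | (M.construction ρ p).flow.InInterval γ p.K ∧ k ≤ p.K ∧
      ¬ B16.UVIneq (M.construction ρ p) k V (em ((M.construction ρ p).flow.g k)) (ep ((M.construction ρ p).flow.g k))}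
  have hE0 : ∀ p, E p 0 = ∅ := fun p => Set.eq_empty_iff_forall_notMem.mpr fun V hV => hV.2.2 (h0 p hV.1 V)
  have hnull : ∀ p k, fieldMeasure (F.P p.K) k G (E p k) = 0 := by
    intro p k
    cases k with
    | zero => rw [hE0 p, measure_empty]
    | succ k =>
      by_cases hP : (M.construction ρ p).flow.InInterval γ p.K ∧ k + 1 ≤ p.K
      · have hae' := hae p hP.1 k hP.2
        rw [Filter.Eventually, mem_ae_iff] at hae'
        exact measure_mono_null (fun V hV => hV.2.2) hae'
      · have hE : E p (k + 1) = ∅ := Set.eq_empty_iff_forall_notMem.mpr fun V hV => hP ⟨hV.1, hV.2.1⟩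
        rw [hE, measure_empty]
  have hoff : ∀ p : B12.RunParams, (M.construction ρ p).flow.InInterval γ p.K → ∀ k, k ≤ p.K → ∀ V, V ∉ E p k →
      B16.UVIneq (M.construction ρ p) k V (em ((M.construction ρ p).flow.g k)) (ep ((M.construction ρ p).flow.g k)) := by
    intro p hP k hk V hV
    by_contra hc
    exact hV ⟨hP, hk, hc⟩
  obtain ⟨ρ', hoffE, hB⟩ := exists_rho_eqOn_endStatementBPrinted_of_thm1_of_offSet (M.construction ρ) E hχ hA h1 hγ hoff
  refine ⟨ρ', fun p => funext fun V => hoffE p 0 V (by rw [hE0 p]; exact Set.notMem_empty V), fun p k => ?_, hB⟩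
  filter_upwards [measure_eq_zero_iff_ae_notMem.1 (hnull p k)] with V hV
  exact hoffE p k V hV

end Generic

/-! ## §2 AT NODE 00's STAGE-13 RECORD, IN THE ENGINES' LETTERS (level 0 at every field, levels ≥ 1 `dV`-a.e.; `SLaw` guard paid by Theorem 1) -/

section Record

variable (F : T4Family) (N : ℕ) [NeZero N] (θ : Stage13HParams F N) (h : θ.Provisos₁₃SepCoPH F N)

/-- **★★★ THE (δⱽ) SLOT's SUPPLIER SHAPE, ENGINES' LETTERS, LEVEL 0 KEPT** (`(datumOfRecord₁₃SepCoPH θ h).C = (coreOfRecord₁₃CoPH F N θ).construction (densOfRecord₁₃ …)`, `rfl`): Theorem 1 at the datum +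
the K1 engines' N13 row `hUV` (window `γ`, guard `SLaw₁₃CoPH`, `em`∕`ep` of `g_k`) with «every `U`» KEPT at level 0 and «`dV`-a.e. `U`» at levels `k+1` ⟹ densities `ρ′` EQUAL to `densOfRecord₁₃ θ P 0` at level 0 and
`=ᵐ[dV] densOfRecord₁₃ θ P k` at every level, with `B16.EndStatementBPrinted (fun P => {(datumOfRecord₁₃SepCoPH θ h).C P with ρ := ρ′ P})` AS TYPED (constants `min γ γ₁`, `em`, `max ep (−em)`) — the hypothesis shape
node00 DEF-1's adapter `exists_revision₁₃_endStatementBPrinted_of_exists_update` turns into `∃ v : Revision₁₃ θ h, B16.EndStatementBPrinted (datumOfRecord₁₃SepCoPHⱽ θ h v).C` (INTENT-10; not imported here).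
[cite: Balaban1989LargeFieldII, Thm 1 + (0.1) pp.355–356; Balaban1988Convergent, Thm 1 p.262, (0.2) p.244, Cor. 3 (2.50) p.264 (bookkeeping)] -/
theorem exists_rho_keep0_ae_eq_endStatementBPrinted_record_of_thm1_of_row0_of_aeRowSucc (h1 : B16.Thm1Printed (datumOfRecord₁₃SepCoPH F N θ h).C) {γ : ℝ} (hγ : 0 < γ)
    {em ep : ℝ → ℝ}
    (hrow0 : ∀ P : B12.RunParams, ((datumOfRecord₁₃SepCoPH F N θ h).C P).flow.InInterval γ P.K → SLaw₁₃CoPH F N θ P 0 →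
      ∀ U : GaugeField (F.P P.K) 0 (SU N),
        chiβOfRecord₁₃ F N θ.toStage13Params P.K (gOfRecord₁₃ F N θ.toStage13Params P) 0 U *
              Real.exp (-(1 / (gOfRecord₁₃ F N θ.toStage13Params P 0) ^ 2 * wilsonBGOfRecord F N θ.εbg P 0 U)
                - em (gOfRecord₁₃ F N θ.toStage13Params P 0) * (Fintype.card (Site (F.P P.K) 0) : ℝ)) ≤ densOfRecord₁₃ F N θ.toStage13Params P 0 U ∧
          densOfRecord₁₃ F N θ.toStage13Params P 0 U ≤ Real.exp (ep (gOfRecord₁₃ F N θ.toStage13Params P 0) * (Fintype.card (Site (F.P P.K) 0) : ℝ)))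
    (hrow : ∀ P : B12.RunParams, ((datumOfRecord₁₃SepCoPH F N θ h).C P).flow.InInterval γ P.K → ∀ k, k + 1 ≤ P.K → SLaw₁₃CoPH F N θ P (k + 1) →
      ∀ᵐ U ∂(fieldMeasure (F.P P.K) (k + 1) (SU N)),
        chiβOfRecord₁₃ F N θ.toStage13Params P.K (gOfRecord₁₃ F N θ.toStage13Params P) (k + 1) U *
              Real.exp (-(1 / (gOfRecord₁₃ F N θ.toStage13Params P (k + 1)) ^ 2 * wilsonBGOfRecord F N θ.εbg P (k + 1) U)
                - em (gOfRecord₁₃ F N θ.toStage13Params P (k + 1)) * (Fintype.card (Site (F.P P.K) (k + 1)) : ℝ)) ≤ densOfRecord₁₃ F N θ.toStage13Params P (k + 1) U ∧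
          densOfRecord₁₃ F N θ.toStage13Params P (k + 1) U ≤ Real.exp (ep (gOfRecord₁₃ F N θ.toStage13Params P (k + 1)) * (Fintype.card (Site (F.P P.K) (k + 1)) : ℝ))) :
    ∃ ρ' : (P : B12.RunParams) → (k : ℕ) → GaugeField (F.P P.K) k (SU N) → ℝ,
      (∀ P, ρ' P 0 = densOfRecord₁₃ F N θ.toStage13Params P 0) ∧
        (∀ P k, ρ' P k =ᵐ[fieldMeasure (F.P P.K) k (SU N)] densOfRecord₁₃ F N θ.toStage13Params P k) ∧
        B16.EndStatementBPrinted (fun P => { (datumOfRecord₁₃SepCoPH F N θ h).C P with ρ := ρ' P }) := by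
  obtain ⟨γ₁, hγ₁, hS⟩ := h1
  have hI : ∀ P : B12.RunParams, ((datumOfRecord₁₃SepCoPH F N θ h).C P).flow.InInterval (min γ γ₁) P.K →
      ((datumOfRecord₁₃SepCoPH F N θ h).C P).flow.InInterval γ P.K ∧ ((datumOfRecord₁₃SepCoPH F N θ h).C P).flow.InInterval γ₁ P.K := fun P hP =>
    ⟨fun j hj => ⟨(hP j hj).1, (hP j hj).2.trans (min_le_left _ _)⟩, fun j hj => ⟨(hP j hj).1, (hP j hj).2.trans (min_le_right _ _)⟩⟩
  exact exists_rho_keep0_ae_eq_endStatementBPrinted_construction_of_thm1_of_ae (coreOfRecord₁₃CoPH F N θ) (densOfRecord₁₃ F N θ.toStage13Params)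
    (fun P k V => (signs_datum F N θ h P k V).1) (fun P k V => (signs_datum F N θ h P k V).2) ⟨γ₁, hγ₁, hS⟩ (lt_min hγ hγ₁) (em := em) (ep := ep)
    (fun P hP V => (uvIneq_at_record₁₃SepCoPH_iff F N θ h P 0 V _ _).mpr (hrow0 P (hI P hP).1 (hS P (hI P hP).2 0 (Nat.zero_le _)) V))
    (fun P hP k hk => by
      filter_upwards [hrow P (hI P hP).1 k hk (hS P (hI P hP).2 (k + 1) hk)] with U hU
      exact (uvIneq_at_record₁₃SepCoPH_iff F N θ h P (k + 1) U _ _).mpr hU)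

/-- **The same with the a.e. clause in DEF-1's GUARDED SUCCESSOR letter** `∀ P k, k < P.K → ρ′ P (k+1) =ᵐ[dV] ρ_{k+1}` (`Revision₁₃.ae_eq_succ`). [cite: Balaban1988Convergent, (0.2) p.244, Cor. 3 (2.50) p.264 (bookkeeping)] -/
theorem exists_rho_keep0_ae_eq_succGuarded_endStatementBPrinted_record_of_thm1_of_row0_of_aeRowSucc (h1 : B16.Thm1Printed (datumOfRecord₁₃SepCoPH F N θ h).C) {γ : ℝ} (hγ : 0 < γ)
    {em ep : ℝ → ℝ}
    (hrow0 : ∀ P : B12.RunParams, ((datumOfRecord₁₃SepCoPH F N θ h).C P).flow.InInterval γ P.K → SLaw₁₃CoPH F N θ P 0 →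
      ∀ U : GaugeField (F.P P.K) 0 (SU N),
        chiβOfRecord₁₃ F N θ.toStage13Params P.K (gOfRecord₁₃ F N θ.toStage13Params P) 0 U *
              Real.exp (-(1 / (gOfRecord₁₃ F N θ.toStage13Params P 0) ^ 2 * wilsonBGOfRecord F N θ.εbg P 0 U)
                - em (gOfRecord₁₃ F N θ.toStage13Params P 0) * (Fintype.card (Site (F.P P.K) 0) : ℝ)) ≤ densOfRecord₁₃ F N θ.toStage13Params P 0 U ∧
          densOfRecord₁₃ F N θ.toStage13Params P 0 U ≤ Real.exp (ep (gOfRecord₁₃ F N θ.toStage13Params P 0) * (Fintype.card (Site (F.P P.K) 0) : ℝ)))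
    (hrow : ∀ P : B12.RunParams, ((datumOfRecord₁₃SepCoPH F N θ h).C P).flow.InInterval γ P.K → ∀ k, k + 1 ≤ P.K → SLaw₁₃CoPH F N θ P (k + 1) →
      ∀ᵐ U ∂(fieldMeasure (F.P P.K) (k + 1) (SU N)),
        chiβOfRecord₁₃ F N θ.toStage13Params P.K (gOfRecord₁₃ F N θ.toStage13Params P) (k + 1) U *
              Real.exp (-(1 / (gOfRecord₁₃ F N θ.toStage13Params P (k + 1)) ^ 2 * wilsonBGOfRecord F N θ.εbg P (k + 1) U)
                - em (gOfRecord₁₃ F N θ.toStage13Params P (k + 1)) * (Fintype.card (Site (F.P P.K) (k + 1)) : ℝ)) ≤ densOfRecord₁₃ F N θ.toStage13Params P (k + 1) U ∧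
          densOfRecord₁₃ F N θ.toStage13Params P (k + 1) U ≤ Real.exp (ep (gOfRecord₁₃ F N θ.toStage13Params P (k + 1)) * (Fintype.card (Site (F.P P.K) (k + 1)) : ℝ))) :
    ∃ ρ' : (P : B12.RunParams) → (k : ℕ) → GaugeField (F.P P.K) k (SU N) → ℝ,
      (∀ P, ρ' P 0 = densOfRecord₁₃ F N θ.toStage13Params P 0) ∧
        (∀ P k, k < P.K → ρ' P (k + 1) =ᵐ[fieldMeasure (F.P P.K) (k + 1) (SU N)] densOfRecord₁₃ F N θ.toStage13Params P (k + 1)) ∧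
        B16.EndStatementBPrinted (fun P => { (datumOfRecord₁₃SepCoPH F N θ h).C P with ρ := ρ' P }) := by
  obtain ⟨ρ', h0, hae, hB⟩ := exists_rho_keep0_ae_eq_endStatementBPrinted_record_of_thm1_of_row0_of_aeRowSucc F N θ h h1 hγ hrow0 hrow
  exact ⟨ρ', h0, fun P k _ => hae P (k + 1), hB⟩

end Record

/-! ## §3 THE A.E. TWIN OF THE LOWER-HALF JUNCTION «it suffices on the small locus» (dag-n13-w1's `uvLower_of_smallLocus`, p593634∕p595529), and the slot's supplier FROM (U) + (Lˢ) a.e. -/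

section SmallLocusAE

variable (F : T4Family) (N : ℕ) [NeZero N]

/-- **A.E. TWIN of dag-n13-w1's `uvLower_of_smallLocus`** (per-field dichotomy, their `uvLower_densOfRecord₁₃_of_plaquette_off_b0` BY NAME for the large-plaquette branch): if the lower inequality of
(UV₁₃) holds for `dV`-a.e. `U` ON THE SMALL LOCUS (all `b₀`-free plaquettes `(2εreg + 4ε₂₉)`-small), it holds for `dV`-a.e. `U` — off the small locus the (2.9) species vanishes and `ρ_k ≥ 0`.
[cite: Balaban1989LargeFieldII, (0.1) pp.355–356; Balaban1988Convergent, (2.50) p.264; Balaban1987RG1, (2.9) p.266; Balaban1985Averaging, Prop. 2 (54) p.26 (bookkeeping)] -/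
theorem ae_uvLower_of_ae_smallLocus (θ : Stage13Params F N) (hζu : IsZetaUnity F N θ.ν θ.τ9.M θ.ζ) (hζa : IsZetaAbsLeOne F N θ.ν θ.τ9.M θ.ζ)
    (hε : 0 < θ.ν.εreg) (P : B12.RunParams) {k : ℕ} (hk : k ≤ (F.P P.K).m + (F.P P.K).K)
    (hε3 : (143 * (((((F.P P.K).d + 4 : ℕ) : ℝ)) ^ 2 / 4) ^ 2) * θ.ν.εreg ≤ 1 / 3)
    (hε2 : 2 * θ.ν.εreg ≤ 2 * deltaSU (Fin N) / ((((F.P P.K).d + 4) * (F.P P.K).L : ℕ) : ℝ) ^ 2) (em : ℝ)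
    (hsmall : ∀ᵐ U ∂(fieldMeasure (F.P P.K) k (SU N)),
      (∀ p : Plaq (F.P P.K) k, ¬ IsB0 (F := F) (⟨p.src, p.μ⟩ : PBond (F.P P.K) k) → ¬ IsB0 (F := F) (⟨p.src.shift p.μ, p.ν⟩ : PBond (F.P P.K) k) →
        ¬ IsB0 (F := F) (⟨p.src.shift p.ν, p.μ⟩ : PBond (F.P P.K) k) → ¬ IsB0 (F := F) (⟨p.src, p.ν⟩ : PBond (F.P P.K) k) →
        dist1 (GaugeField.plaqHol U p) < 2 * θ.ν.εreg + 4 * θ.ε₂₉) →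
      chiβOfRecord₁₃ F N θ P.K (gOfRecord₁₃ F N θ P) k U *
          Real.exp (-(1 / (gOfRecord₁₃ F N θ P k) ^ 2 * wilsonBGOfRecord F N θ.εbg P k U) - em * (Fintype.card (Site (F.P P.K) k) : ℝ)) ≤
        densOfRecord₁₃ F N θ P k U) :
    ∀ᵐ U ∂(fieldMeasure (F.P P.K) k (SU N)),
      chiβOfRecord₁₃ F N θ P.K (gOfRecord₁₃ F N θ P) k U *
          Real.exp (-(1 / (gOfRecord₁₃ F N θ P k) ^ 2 * wilsonBGOfRecord F N θ.εbg P k U) - em * (Fintype.card (Site (F.P P.K) k) : ℝ)) ≤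
        densOfRecord₁₃ F N θ P k U := by
  filter_upwards [hsmall] with U hU
  by_cases hbig : ∃ p : Plaq (F.P P.K) k, ¬ IsB0 (F := F) (⟨p.src, p.μ⟩ : PBond (F.P P.K) k) ∧ ¬ IsB0 (F := F) (⟨p.src.shift p.μ, p.ν⟩ : PBond (F.P P.K) k) ∧
      ¬ IsB0 (F := F) (⟨p.src.shift p.ν, p.μ⟩ : PBond (F.P P.K) k) ∧ ¬ IsB0 (F := F) (⟨p.src, p.ν⟩ : PBond (F.P P.K) k) ∧
      2 * θ.ν.εreg + 4 * θ.ε₂₉ ≤ dist1 (GaugeField.plaqHol U p)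
  · obtain ⟨p, h₁, h₂, h₃, h₄, hge⟩ := hbig
    exact uvLower_densOfRecord₁₃_of_plaquette_off_b0 θ hζu hζa hε P hk hε3 hε2 U p h₁ h₂ h₃ h₄ hge em
  · exact hU fun p h₁ h₂ h₃ h₄ => lt_of_not_ge fun hge => hbig ⟨p, h₁, h₂, h₃, h₄, hge⟩

variable (θ : Stage13HParams F N) (h : θ.Provisos₁₃SepCoPH F N)

/-- **★★★ THE SLOT's SUPPLIER FROM (U) «upper half» + (Lˢ) «lower half on the small locus», BOTH `dV`-A.E. AT LEVELS ≥ 1, and the level-0 row at every field** (`εreg` in [Av] Prop. 2's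
range as in dag-n13-w1's `hUV₁₃_of_upper_of_lowerSmallLocus`; ζ-laws from `Provisos₁₃SepCoPH`): with Theorem 1 at the datum ⟹ `ρ′` equal to the record's density at level 0, `=ᵐ` at every
level, and `B16.EndStatementBPrinted (fun P => {(datumOfRecord₁₃SepCoPH θ h).C P with ρ := ρ′ P})`.  The (U)∕(Lˢ) leaves at levels ≥ 1 are thus asked only VERSION-FREE (director-ym №210 (5)).
[cite: Balaban1989LargeFieldII, Thm 1 + (0.1) pp.355–356; Balaban1988Convergent, Thm 1 p.262, Cor. 3 (2.50) p.264; Balaban1987RG1, (2.9) p.266; Balaban1985Averaging, Prop. 2 (54) p.26 (bookkeeping)] -/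
theorem exists_rho_keep0_ae_eq_endStatementBPrinted_record_of_thm1_of_row0_of_aeUpper_of_aeLowerSmall (hε : 0 < θ.ν.εreg)
    (hε3 : (143 * ((((4 + 4 : ℕ) : ℝ)) ^ 2 / 4) ^ 2) * θ.ν.εreg ≤ 1 / 3) (hε2 : 2 * θ.ν.εreg ≤ 2 * deltaSU (Fin N) / ((((4 + 4) * F.L : ℕ) : ℝ) ^ 2))
    (h1 : B16.Thm1Printed (datumOfRecord₁₃SepCoPH F N θ h).C) {γ : ℝ} (hγ : 0 < γ) {em ep : ℝ → ℝ}
    (hrow0 : ∀ P : B12.RunParams, ((datumOfRecord₁₃SepCoPH F N θ h).C P).flow.InInterval γ P.K → SLaw₁₃CoPH F N θ P 0 →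
      ∀ U : GaugeField (F.P P.K) 0 (SU N),
        chiβOfRecord₁₃ F N θ.toStage13Params P.K (gOfRecord₁₃ F N θ.toStage13Params P) 0 U *
              Real.exp (-(1 / (gOfRecord₁₃ F N θ.toStage13Params P 0) ^ 2 * wilsonBGOfRecord F N θ.εbg P 0 U)
                - em (gOfRecord₁₃ F N θ.toStage13Params P 0) * (Fintype.card (Site (F.P P.K) 0) : ℝ)) ≤ densOfRecord₁₃ F N θ.toStage13Params P 0 U ∧
          densOfRecord₁₃ F N θ.toStage13Params P 0 U ≤ Real.exp (ep (gOfRecord₁₃ F N θ.toStage13Params P 0) * (Fintype.card (Site (F.P P.K) 0) : ℝ)))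
    (hupper : ∀ P : B12.RunParams, ((datumOfRecord₁₃SepCoPH F N θ h).C P).flow.InInterval γ P.K → ∀ k, k + 1 ≤ P.K → SLaw₁₃CoPH F N θ P (k + 1) →
      ∀ᵐ U ∂(fieldMeasure (F.P P.K) (k + 1) (SU N)),
        densOfRecord₁₃ F N θ.toStage13Params P (k + 1) U ≤ Real.exp (ep (gOfRecord₁₃ F N θ.toStage13Params P (k + 1)) * (Fintype.card (Site (F.P P.K) (k + 1)) : ℝ)))
    (hlowerSmall : ∀ P : B12.RunParams, ((datumOfRecord₁₃SepCoPH F N θ h).C P).flow.InInterval γ P.K → ∀ k, k + 1 ≤ P.K → SLaw₁₃CoPH F N θ P (k + 1) →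
      ∀ᵐ U ∂(fieldMeasure (F.P P.K) (k + 1) (SU N)),
        (∀ p : Plaq (F.P P.K) (k + 1), ¬ IsB0 (F := F) (⟨p.src, p.μ⟩ : PBond (F.P P.K) (k + 1)) → ¬ IsB0 (F := F) (⟨p.src.shift p.μ, p.ν⟩ : PBond (F.P P.K) (k + 1)) →
          ¬ IsB0 (F := F) (⟨p.src.shift p.ν, p.μ⟩ : PBond (F.P P.K) (k + 1)) → ¬ IsB0 (F := F) (⟨p.src, p.ν⟩ : PBond (F.P P.K) (k + 1)) →
          dist1 (GaugeField.plaqHol U p) < 2 * θ.ν.εreg + 4 * θ.ε₂₉) →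
        chiβOfRecord₁₃ F N θ.toStage13Params P.K (gOfRecord₁₃ F N θ.toStage13Params P) (k + 1) U *
            Real.exp (-(1 / (gOfRecord₁₃ F N θ.toStage13Params P (k + 1)) ^ 2 * wilsonBGOfRecord F N θ.εbg P (k + 1) U)
              - em (gOfRecord₁₃ F N θ.toStage13Params P (k + 1)) * (Fintype.card (Site (F.P P.K) (k + 1)) : ℝ)) ≤ densOfRecord₁₃ F N θ.toStage13Params P (k + 1) U) :
    ∃ ρ' : (P : B12.RunParams) → (k : ℕ) → GaugeField (F.P P.K) k (SU N) → ℝ,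
      (∀ P, ρ' P 0 = densOfRecord₁₃ F N θ.toStage13Params P 0) ∧
        (∀ P k, ρ' P k =ᵐ[fieldMeasure (F.P P.K) k (SU N)] densOfRecord₁₃ F N θ.toStage13Params P k) ∧
        B16.EndStatementBPrinted (fun P => { (datumOfRecord₁₃SepCoPH F N θ h).C P with ρ := ρ' P }) := by
  refine exists_rho_keep0_ae_eq_endStatementBPrinted_record_of_thm1_of_row0_of_aeRowSucc F N θ h h1 hγ hrow0 fun P hP k hk hS => ?_
  filter_upwards [hupper P hP k hk hS, ae_uvLower_of_ae_smallLocus F N θ.toStage13Params h.zetaUnity h.zetaAbs hε P (le_m_add_K_of_le hk) hε3 hε2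
    (em (gOfRecord₁₃ F N θ.toStage13Params P (k + 1))) (hlowerSmall P hP k hk hS)] with U hu hl
  exact ⟨hl, hu⟩

end SmallLocusAE

/-! ## §4 THROUGH node00 DEF-1's VERSION SLOT (p620607 `Node00/Record13SepCoPHV`): the K1⁹-shaped conjunct `∃ v : Revision₁₃ θ h, B16.EndStatementBPrinted (datumOfRecord₁₃SepCoPHⱽ θ h v).C` -/

section Slot

variable (F : T4Family) (N : ℕ) [NeZero N] (θ : Stage13HParams F N) (h : θ.Provisos₁₃SepCoPH F N)

/-- **★★★ THE REVISED (B)-CONJUNCT FROM THE ENGINES' ROW**: Theorem 1 at the datum + the K1 engines' N13 row `hUV` with «every `U`» at level 0 and «`dV`-a.e. `U`» at levels ≥ 1 ⟹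
`∃ v : Revision₁₃ F N θ h, B16.EndStatementBPrinted (datumOfRecord₁₃SepCoPHV F N θ h v).C` — §2's supplier fed to DEF-1's adapter `exists_revision₁₃_endStatementBPrinted_of_exists_update`
BY NAME.  The display letter of plan g84∕g85's K1⁹ (B)-slot; K1⁸∕K1⁹ neither proved nor refuted here (the row is a HYPOTHESIS).
[cite: Balaban1989LargeFieldII, Thm 1 + (0.1) pp.355–356; Balaban1988Convergent, Thm 1 p.262, (0.2) p.244, Cor. 3 (2.50) p.264 (bookkeeping)] -/
theorem exists_revision₁₃_endStatementBPrinted_of_thm1_of_row0_of_aeRowSucc (h1 : B16.Thm1Printed (datumOfRecord₁₃SepCoPH F N θ h).C) {γ : ℝ} (hγ : 0 < γ)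
    {em ep : ℝ → ℝ}
    (hrow0 : ∀ P : B12.RunParams, ((datumOfRecord₁₃SepCoPH F N θ h).C P).flow.InInterval γ P.K → SLaw₁₃CoPH F N θ P 0 →
      ∀ U : GaugeField (F.P P.K) 0 (SU N),
        chiβOfRecord₁₃ F N θ.toStage13Params P.K (gOfRecord₁₃ F N θ.toStage13Params P) 0 U *
              Real.exp (-(1 / (gOfRecord₁₃ F N θ.toStage13Params P 0) ^ 2 * wilsonBGOfRecord F N θ.εbg P 0 U)
                - em (gOfRecord₁₃ F N θ.toStage13Params P 0) * (Fintype.card (Site (F.P P.K) 0) : ℝ)) ≤ densOfRecord₁₃ F N θ.toStage13Params P 0 U ∧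
          densOfRecord₁₃ F N θ.toStage13Params P 0 U ≤ Real.exp (ep (gOfRecord₁₃ F N θ.toStage13Params P 0) * (Fintype.card (Site (F.P P.K) 0) : ℝ)))
    (hrow : ∀ P : B12.RunParams, ((datumOfRecord₁₃SepCoPH F N θ h).C P).flow.InInterval γ P.K → ∀ k, k + 1 ≤ P.K → SLaw₁₃CoPH F N θ P (k + 1) →
      ∀ᵐ U ∂(fieldMeasure (F.P P.K) (k + 1) (SU N)),
        chiβOfRecord₁₃ F N θ.toStage13Params P.K (gOfRecord₁₃ F N θ.toStage13Params P) (k + 1) U *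
              Real.exp (-(1 / (gOfRecord₁₃ F N θ.toStage13Params P (k + 1)) ^ 2 * wilsonBGOfRecord F N θ.εbg P (k + 1) U)
                - em (gOfRecord₁₃ F N θ.toStage13Params P (k + 1)) * (Fintype.card (Site (F.P P.K) (k + 1)) : ℝ)) ≤ densOfRecord₁₃ F N θ.toStage13Params P (k + 1) U ∧
          densOfRecord₁₃ F N θ.toStage13Params P (k + 1) U ≤ Real.exp (ep (gOfRecord₁₃ F N θ.toStage13Params P (k + 1)) * (Fintype.card (Site (F.P P.K) (k + 1)) : ℝ))) :
    ∃ v : Revision₁₃ F N θ h, B16.EndStatementBPrinted (datumOfRecord₁₃SepCoPHV F N θ h v).C :=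
  exists_revision₁₃_endStatementBPrinted_of_exists_update F N θ h
    (exists_rho_keep0_ae_eq_succGuarded_endStatementBPrinted_record_of_thm1_of_row0_of_aeRowSucc F N θ h h1 hγ hrow0 hrow)

/-- **★★★ THE REVISED (B)-CONJUNCT FROM (U) + (Lˢ), version-free at levels ≥ 1** (§3's supplier through the same adapter). [cite: Balaban1989LargeFieldII, Thm 1 + (0.1) pp.355–356; Balaban1988Convergent, Cor. 3 (2.50) p.264; Balaban1987RG1, (2.9) p.266; Balaban1985Averaging, Prop. 2 (54) p.26 (bookkeeping)] -/
theorem exists_revision₁₃_endStatementBPrinted_of_thm1_of_row0_of_aeUpper_of_aeLowerSmall (hε : 0 < θ.ν.εreg)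
    (hε3 : (143 * ((((4 + 4 : ℕ) : ℝ)) ^ 2 / 4) ^ 2) * θ.ν.εreg ≤ 1 / 3) (hε2 : 2 * θ.ν.εreg ≤ 2 * deltaSU (Fin N) / ((((4 + 4) * F.L : ℕ) : ℝ) ^ 2))
    (h1 : B16.Thm1Printed (datumOfRecord₁₃SepCoPH F N θ h).C) {γ : ℝ} (hγ : 0 < γ) {em ep : ℝ → ℝ}
    (hrow0 : ∀ P : B12.RunParams, ((datumOfRecord₁₃SepCoPH F N θ h).C P).flow.InInterval γ P.K → SLaw₁₃CoPH F N θ P 0 →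
      ∀ U : GaugeField (F.P P.K) 0 (SU N),
        chiβOfRecord₁₃ F N θ.toStage13Params P.K (gOfRecord₁₃ F N θ.toStage13Params P) 0 U *
              Real.exp (-(1 / (gOfRecord₁₃ F N θ.toStage13Params P 0) ^ 2 * wilsonBGOfRecord F N θ.εbg P 0 U)
                - em (gOfRecord₁₃ F N θ.toStage13Params P 0) * (Fintype.card (Site (F.P P.K) 0) : ℝ)) ≤ densOfRecord₁₃ F N θ.toStage13Params P 0 U ∧
          densOfRecord₁₃ F N θ.toStage13Params P 0 U ≤ Real.exp (ep (gOfRecord₁₃ F N θ.toStage13Params P 0) * (Fintype.card (Site (F.P P.K) 0) : ℝ)))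
    (hupper : ∀ P : B12.RunParams, ((datumOfRecord₁₃SepCoPH F N θ h).C P).flow.InInterval γ P.K → ∀ k, k + 1 ≤ P.K → SLaw₁₃CoPH F N θ P (k + 1) →
      ∀ᵐ U ∂(fieldMeasure (F.P P.K) (k + 1) (SU N)),
        densOfRecord₁₃ F N θ.toStage13Params P (k + 1) U ≤ Real.exp (ep (gOfRecord₁₃ F N θ.toStage13Params P (k + 1)) * (Fintype.card (Site (F.P P.K) (k + 1)) : ℝ)))
    (hlowerSmall : ∀ P : B12.RunParams, ((datumOfRecord₁₃SepCoPH F N θ h).C P).flow.InInterval γ P.K → ∀ k, k + 1 ≤ P.K → SLaw₁₃CoPH F N θ P (k + 1) →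
      ∀ᵐ U ∂(fieldMeasure (F.P P.K) (k + 1) (SU N)),
        (∀ p : Plaq (F.P P.K) (k + 1), ¬ IsB0 (F := F) (⟨p.src, p.μ⟩ : PBond (F.P P.K) (k + 1)) → ¬ IsB0 (F := F) (⟨p.src.shift p.μ, p.ν⟩ : PBond (F.P P.K) (k + 1)) →
          ¬ IsB0 (F := F) (⟨p.src.shift p.ν, p.μ⟩ : PBond (F.P P.K) (k + 1)) → ¬ IsB0 (F := F) (⟨p.src, p.ν⟩ : PBond (F.P P.K) (k + 1)) →
          dist1 (GaugeField.plaqHol U p) < 2 * θ.ν.εreg + 4 * θ.ε₂₉) →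
        chiβOfRecord₁₃ F N θ.toStage13Params P.K (gOfRecord₁₃ F N θ.toStage13Params P) (k + 1) U *
            Real.exp (-(1 / (gOfRecord₁₃ F N θ.toStage13Params P (k + 1)) ^ 2 * wilsonBGOfRecord F N θ.εbg P (k + 1) U)
              - em (gOfRecord₁₃ F N θ.toStage13Params P (k + 1)) * (Fintype.card (Site (F.P P.K) (k + 1)) : ℝ)) ≤ densOfRecord₁₃ F N θ.toStage13Params P (k + 1) U) :
    ∃ v : Revision₁₃ F N θ h, B16.EndStatementBPrinted (datumOfRecord₁₃SepCoPHV F N θ h v).C := by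
  obtain ⟨ρ', h0, hae, hB⟩ :=
    exists_rho_keep0_ae_eq_endStatementBPrinted_record_of_thm1_of_row0_of_aeUpper_of_aeLowerSmall F N θ h hε hε3 hε2 h1 hγ hrow0 hupper hlowerSmall
  exact exists_revision₁₃_endStatementBPrinted_of_exists_update F N θ h ⟨ρ', h0, fun P k _ => hae P (k + 1), hB⟩

end Slot

end Summit.QuantumFields.YangMills.BalabanUVNodes.N13Cor3AEKeepZeroOfEnginesRowAtRecord13

end
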